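import Literature.Geometry.GeometricMeasureTheory.PushforwardProductRectifiable
import Literature.Geometry.GeometricMeasureTheory.CurrentsNullCarrier

/-!
# Homotopies through a null set: `(G ∘ h)_# T = G_# T` up to a rim term

Let `T ∈ 𝓡_{m+1}(V)` be a rectifiable current with compact support, `h : V → V` and
`G : V → V'` smooth, and `H(s, x) = G(x + s (h x − x))` the image under `G` of the affine
homotopy from `id` to `h` (`imageHomotopy`). If the homotopy sweeps a **`𝓗^{m+2}`-null set**,
`𝓗^{m+2}(H([0,1] × spt T)) = 0` (e.g. `G` takes values in an `(m+1)`-dimensional graph), then the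
homotopy current `H_#([0,1] × T)` — rectifiable by `Current.IsRectifiable.pushforward_prodInterval_top`
— vanishes (`Current.IsLocallyRectifiable.eq_zero_of_support_subset_null`), and the homotopy
formula (`Current.homotopy_formula`) collapses to

`(G ∘ h)_# T − G_# T = H_#([0,1] × ∂T)`  (`Current.pushforward_comp_sub_pushforward_eq_rim`),

a current supported in `H([0,1] × spt ∂T)` (`Current.support_rim_subset`). When `∂T` lives on a
rim which `H` keeps away from a region, `(G ∘ h)_# T` and `G_# T` agree there
(`Current.pushforward_comp_apply_eq_of_rim`).

Theorems only (and the definition of the homotopy); no named facts.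

## References

* H. Federer, *Geometric Measure Theory*, Springer 1969, 4.1.9, 4.1.30 [Federer1969].
-/

noncomputable section

open scoped Topology ENNReal NNReal Distributions ContDiff
open MeasureTheory TopologicalSpace Set Filter Metric Function

namespace Literature.Geometry.GeometricMeasureTheory

variable {V : Type*} [NormedAddCommGroup V] [InnerProductSpace ℝ V] [FiniteDimensional ℝ V]
  [MeasurableSpace V] [BorelSpace V]
  {V' : Type*} [NormedAddCommGroup V'] [InnerProductSpace ℝ V'] [FiniteDimensional ℝ V']
  [MeasurableSpace V'] [BorelSpace V'] {m : ℕ}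

/-- **The homotopy `H(s, x) = G(x + s (h x − x))`.** [cite: Federer1969, 4.1.9] -/
def imageHomotopy (G : V → V') (h : V → V) : ℝ × V → V' := fun p => G (p.2 + p.1 • (h p.2 - p.2))

omit [FiniteDimensional ℝ V] [MeasurableSpace V] [BorelSpace V]
  [InnerProductSpace ℝ V'] [FiniteDimensional ℝ V'] [MeasurableSpace V'] [BorelSpace V'] in
/-- Unfolding the homotopy. [folklore] -/
@[simp] theorem imageHomotopy_apply {V' : Type*} (G : V → V') (h : V → V) (p : ℝ × V) :
    imageHomotopy G h p = G (p.2 + p.1 • (h p.2 - p.2)) := rfl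

omit [FiniteDimensional ℝ V] [MeasurableSpace V] [BorelSpace V]
  [FiniteDimensional ℝ V'] [MeasurableSpace V'] [BorelSpace V'] in
/-- The homotopy is smooth. [folklore] -/
theorem contDiff_imageHomotopy {G : V → V'} {h : V → V}
    (hG : ContDiff ℝ ∞ G) (hh : ContDiff ℝ ∞ h) : ContDiff ℝ ∞ (imageHomotopy G h) :=
  hG.comp (contDiff_snd.add (contDiff_fst.smul ((hh.comp contDiff_snd).sub contDiff_snd)))

omit [FiniteDimensional ℝ V] [MeasurableSpace V] [BorelSpace V] in
/-- `spt (dφ) ⊆ spt φ` (a copy of `TestForm.tsupport_extDerivCLM_subset` from `FlatComplete.lean`,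
to keep the imports light). [folklore] -/
private theorem tsupport_extDerivCLM_subset_aux {Ω : Opens V} {k : ℕ}
    (φ : TestForm Ω k) : tsupport ⇑(TestForm.extDerivCLM φ) ⊆ tsupport ⇑φ := by
  rw [TestForm.extDerivCLM_apply]
  refine closure_minimal (fun x hx => ?_) (isClosed_tsupport _)
  refine support_fderiv_subset ℝ (fun h => hx ?_)
  change ContinuousAlternatingMap.alternatizeUncurryFin (fderiv ℝ (⇑φ) x) = 0
  rw [h]
  exact map_zero (ContinuousAlternatingMap.alternatizeUncurryFinCLM ℝ V ℝ)

omit [FiniteDimensional ℝ V] [MeasurableSpace V] [BorelSpace V] in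
/-- `spt ∂S ⊆ spt S` (a copy of `Current.support_boundary_subset` from `FlatComplete.lean`).
[folklore] -/
private theorem support_boundary_subset_aux {Ω : Opens V} {k : ℕ}
    (S : Current Ω (k + 1)) : S.boundary.support ⊆ S.support := by
  intro x hx
  refine ⟨hx.1, fun U hU => ?_⟩
  obtain ⟨φ, hφ, hne⟩ := hx.2 U hU
  exact ⟨TestForm.extDerivCLM φ, (tsupport_extDerivCLM_subset_aux φ).trans hφ, hne⟩

/-- **`(G ∘ h)_# T − G_# T = H_#([0,1] × ∂T)` when the homotopy sweeps a null set.** Here `T` is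
rectifiable with compact support, `χ` is a cylinder cutoff equal to `1` on an open
`U ⊇ [0,1] × spt T`, and the two push-forwards carry the sliced cutoffs `χ(1, ·)`, `χ(0, ·)`.
[cite: Federer1969, 4.1.9, 4.1.30] -/
theorem Current.pushforward_comp_sub_pushforward_eq_rim {T : Current (⊤ : Opens V) (m + 1)}
    (hT : T.IsRectifiable) {h : V → V} (hh : ContDiff ℝ ∞ h) {G : V → V'} (hG : ContDiff ℝ ∞ G)
    (χ : 𝓓(cylinder (⊤ : Opens V), ℝ)) {U : Set (ℝ × V)} (hU : IsOpen U)
    (hTU : Icc (0 : ℝ) 1 ×ˢ T.support ⊆ U) (hχ : ∀ p ∈ U, χ p = 1)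
    (hnull : (μHE[m + 1 + 1] : Measure V') (imageHomotopy G h '' (Icc (0 : ℝ) 1 ×ˢ T.support)) = 0) :
    T.pushforward ⊤ (TestFunction.scalarSlice χ 1) (hG.comp hh) -
        T.pushforward ⊤ (TestFunction.scalarSlice χ 0) hG =
      (T.boundary.prodInterval 0 1).pushforward ⊤ χ (contDiff_imageHomotopy hG hh) := by
  have hH := contDiff_imageHomotopy hG hh
  have hTU' : (T.prodInterval 0 1).support ⊆ U :=
    (T.support_prodInterval_subset 0 1).trans (by rw [uIcc_of_le zero_le_one]; exact hTU)
  have hform := T.homotopy_formula (Ω' := (⊤ : Opens V')) χ hH hU hTU' hχ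
  -- the homotopy current is rectifiable and carried by a null set, hence zero
  set S := (T.prodInterval 0 1).pushforward (⊤ : Opens V') χ hH with hS
  have hSr : S.IsRectifiable := hT.pushforward_prodInterval_top χ (fun p hp => hχ p (hTU hp)) hH
  have hKc : IsCompact (imageHomotopy G h '' (Icc (0 : ℝ) 1 ×ˢ T.support)) :=
    (isCompact_Icc.prod hT.2).image hH.continuous
  have hSsupp : S.support ⊆ imageHomotopy G h '' (Icc (0 : ℝ) 1 ×ˢ T.support) := by
    refine ((T.prodInterval 0 1).support_pushforward_subset χ hH).trans (closure_minimal ?_ hKc.isClosed)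
    refine image_mono (inter_subset_right.trans ?_)
    exact (T.support_prodInterval_subset 0 1).trans (by rw [uIcc_of_le zero_le_one])
  have hS0 : S = 0 := hSr.1.eq_zero_of_support_subset_null hSsupp hnull
  -- the end maps
  have h1 : T.pushforward ⊤ (TestFunction.scalarSlice χ 1) (hH.comp (contDiff_sliceMap 1)) =
      T.pushforward ⊤ (TestFunction.scalarSlice χ 1) (hG.comp hh) :=
    T.pushforward_congr_fun _ (hH.comp (contDiff_sliceMap 1)) (hG.comp hh) fun x => by
      simp [imageHomotopy]
  have h0 : T.pushforward ⊤ (TestFunction.scalarSlice χ 0) (hH.comp (contDiff_sliceMap 0)) =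
      T.pushforward ⊤ (TestFunction.scalarSlice χ 0) hG :=
    T.pushforward_congr_fun _ (hH.comp (contDiff_sliceMap 0)) hG fun x => by
      simp [imageHomotopy]
  rw [h1, h0] at hform
  have hb : S.boundary = 0 := by rw [hS0]; exact Current.boundary_zero
  rw [hb] at hform
  -- `0 = A - B - R`
  exact sub_eq_zero.1 hform.symm

omit [InnerProductSpace ℝ V] [FiniteDimensional ℝ V] [MeasurableSpace V] [BorelSpace V] in
/-- The support of a current on the whole space is closed. [cite: Federer1969, 4.1.1] -/
theorem Current.isClosed_support_top [NormedSpace ℝ V] {k : ℕ} (T : Current (⊤ : Opens V) k) :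
    IsClosed T.support := by
  rw [← isOpen_compl_iff, isOpen_iff_mem_nhds]
  intro x hx
  obtain ⟨U, hU, hTU⟩ := T.exists_nhds_of_not_mem_support (mem_univ x) hx
  obtain ⟨U', hU'U, hU'o, hxU'⟩ := _root_.mem_nhds_iff.1 hU
  refine mem_of_superset (hU'o.mem_nhds hxU') fun y hy hyT => ?_
  obtain ⟨φ, hφ, hne⟩ := hyT.2 U' (hU'o.mem_nhds hy)
  exact hne (hTU φ (hφ.trans hU'U))

omit [MeasurableSpace V] [BorelSpace V] [FiniteDimensional ℝ V'] [MeasurableSpace V'] [BorelSpace V'] in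
/-- **The rim term is supported in `H([0,1] × spt ∂T)`.** [cite: Federer1969, 4.1.9] -/
theorem Current.support_rim_subset {T : Current (⊤ : Opens V) (m + 1)} (hT : IsCompact T.support)
    {h : V → V} (hh : ContDiff ℝ ∞ h) {G : V → V'} (hG : ContDiff ℝ ∞ G)
    (χ : 𝓓(cylinder (⊤ : Opens V), ℝ)) :
    ((T.boundary.prodInterval 0 1).pushforward ⊤ χ (contDiff_imageHomotopy hG hh)).support ⊆
      imageHomotopy G h '' (Icc (0 : ℝ) 1 ×ˢ T.boundary.support) := by
  have hH := contDiff_imageHomotopy hG hh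
  have hcl : IsClosed T.boundary.support := T.boundary.isClosed_support_top
  have hKc : IsCompact (Icc (0 : ℝ) 1 ×ˢ T.boundary.support) :=
    (isCompact_Icc.prod hT).of_isClosed_subset (isClosed_Icc.prod hcl)
      (prod_mono Subset.rfl (support_boundary_subset_aux T))
  refine ((T.boundary.prodInterval 0 1).support_pushforward_subset χ hH).trans
    (closure_minimal ?_ (hKc.image hH.continuous).isClosed)
  refine image_mono (inter_subset_right.trans ?_)
  exact (T.boundary.support_prodInterval_subset 0 1).trans (by rw [uIcc_of_le zero_le_one])

/-- **`(G ∘ h)_# T` and `G_# T` agree away from the swept rim**: if the homotopy sweeps a null set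
and keeps `[0,1] × spt ∂T` off an open set `O`, then `((G ∘ h)_# T)(ψ) = (G_# T)(ψ)` for every
test form `ψ` supported in `O`. [cite: Federer1969, 4.1.9, 4.1.30] -/
theorem Current.pushforward_comp_apply_eq_of_rim {T : Current (⊤ : Opens V) (m + 1)}
    (hT : T.IsRectifiable) {h : V → V} (hh : ContDiff ℝ ∞ h) {G : V → V'} (hG : ContDiff ℝ ∞ G)
    (χ : 𝓓(cylinder (⊤ : Opens V), ℝ)) {U : Set (ℝ × V)} (hU : IsOpen U)
    (hTU : Icc (0 : ℝ) 1 ×ˢ T.support ⊆ U) (hχ : ∀ p ∈ U, χ p = 1)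
    (hnull : (μHE[m + 1 + 1] : Measure V') (imageHomotopy G h '' (Icc (0 : ℝ) 1 ×ˢ T.support)) = 0)
    {O : Set V'} (hrim : ∀ s ∈ Icc (0 : ℝ) 1, ∀ x ∈ T.boundary.support, imageHomotopy G h (s, x) ∉ O)
    (ψ : TestForm (⊤ : Opens V') (m + 1)) (hψ : tsupport ⇑ψ ⊆ O) :
    T.pushforward ⊤ (TestFunction.scalarSlice χ 1) (hG.comp hh) ψ =
      T.pushforward ⊤ (TestFunction.scalarSlice χ 0) hG ψ := by
  have key := Current.pushforward_comp_sub_pushforward_eq_rim hT hh hG χ hU hTU hχ hnull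
  have h0 : (T.boundary.prodInterval 0 1).pushforward ⊤ χ (contDiff_imageHomotopy hG hh) ψ = 0 := by
    refine Current.apply_eq_zero_of_disjoint_support _ (Set.disjoint_left.2 fun y hyψ hyR => ?_)
    obtain ⟨⟨s, x⟩, ⟨hs, hx⟩, rfl⟩ := Current.support_rim_subset hT.2 hh hG χ hyR
    exact hrim s hs x hx (hψ hyψ)
  have := congrArg (fun S : Current (⊤ : Opens V') (m + 1) => S ψ) key
  simp only [_root_.sub_apply, h0] at this
  linarith

end Literature.Geometry.GeometricMeasureTheory
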